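/-
Copyright (c) 2026 the pub-hodgecm-mathlib formalisation cell (harness21).  Prover seat hodgecm-mathlib-K2Liu-p09 (g6): Track B «K2-LIT»,
hLiu418 = stmt-HodgeConjecture-24832; LEAD F0P6-plan RULING M-158d «A7-val road (σ)», instance layer I-3a (the Levi law `hM` of the (A4″-KR) instance).
-/
import Summits.HodgeConjecture.HodgeConjecture.Theorems.K2LiuA7ValueInstanceDefs            -- ★ I-2 p860501 (`leviDeltaLoc`, `leviBlkD`, `leviRhoLoc`; brings ★ I-0 bridge, ★ I-1b blocks)
import Summits.HodgeConjecture.HodgeConjecture.Theorems.K2LiuDeltaSpTransportSiegelJunction  -- ★ A2d junction (`proj_transport_eq`; brings ★ A2c `exists_character_toRep_eq_smul`, ★ β-1, ★ β-3)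
import Literature.NumberTheory.Automorphic.LocalPiSchwartzBruhatFourier                    -- ★ `piPrimePowBall`, `indicator_piPrimePowBall_mem_schwartzBruhat`, `zero_mem_piPrimePowBall`
import HarnessLib

/-!
# Crux `HLiu418`, road `K2_Liu`, organ A7-val, instance layer I-3a: THE LEVI LAW `hM` — `ω(m ⊗ 1) = χ_M(m) • leviEquivSB (aX m)` ON THE SIEGEL LEVI

Cell `hodgecm-mathlib`, crux item hLiu418 = `stmt-HodgeConjecture-24832`; squad K2 ∕ K2Liu; prover K2Liu-p09 (g6), organ lead A7-val.  THEOREMS ONLY; lane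
`--supports stmt-HodgeConjecture-24832` (count-neutral helper).  The K2Lit CM datum `(L, e, dV, dW)` (small group `H_v = U(𝔻)(L⁺_v)`), the auxiliary frame
`dV′` (`V′`), ★ D-A v1 tensor frames `(eW, e′)`, finite place `v`; the big doubled datum `𝔻 ⊗ V′`; a CM-model splitting `s_𝔻` of the BIG group lying over `ι`
(binder `hsproj`, ★ `proj_localSplitting` at the instance) and a Δ-intertwiner `Γ` (★ β-3); `s^Δ_B := mpTransportLoc Γ ∘ s_𝔻 ∘ tensorEmbLoc` (the splitting of
record of the face over `H_v`).
* **`exists_character_toRep_levi`** — THE BINDER `hM` of ★ V8e `K2LiuA7ValueFaceTwo.face_two_of_laws` at the instance: there is a character `χ_M : M_Δ →* ℂˣ` with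
  `ω^Δ(s^Δ_B m) Φ = χ_M(m) • leviEquivSB (aX m) Φ` for every `m` in the Siegel Levi `M_Δ` (★ I-2 `leviDeltaLoc`, `aX = leviRhoLoc`) and every `Φ ∈ 𝒮(X_Δ)`
  — ★ A2c `exists_character_toRep_eq_smul` (implementers unique up to scalars, ★ `implementerUniqueUpToScalar_localSchrodingerDelta`) fed with: `m ⊗ 1` is
  block-diagonal (★ I-1b), so its `ℓ_Δ`-adapted symplectic letter is `leviSp (leviAct D(m ⊗ 1)) d` (★ I-0 bridge `exists_deltaTransport_iotaD_eq_leviSp_leviAct`),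
  which is `proj (s^Δ_B m)` (★ A2d junction `proj_transport_eq`); `𝒮(X_Δ) ≠ 0` (the box indicator, ★ `indicator_piPrimePowBall_mem_schwartzBruhat`).
HONEST LABEL.  `HC_CM` is proved only modulo the 7 printed citations (2 remaining named inputs: hLiu418 = `stmt-HodgeConjecture-24832`,
h413 = `stmt-HodgeConjecture-24833`) until rung 0 closes.

## References
* [Kudla1994] S. Kudla, Israel J. Math. 87 (1994), §3 Thm. 3.1 (the Siegel Levi acts by `χ(det a)|det a|^{m∕2} Φ(xa)`).
* [MoeglinVignerasWaldspurger1987] C. Mœglin, M.-F. Vignéras, J.-L. Waldspurger, LNM 1291, Chap. 2 II.1 (A)(B), II.6.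
* [HarrisKudlaSweet1996] M. Harris, S. Kudla, W. J. Sweet, J. AMS 9 (1996), §1 (1.8), (1.11).
-/

set_option autoImplicit false
set_option linter.dupNamespace false -- the mandated namespace repeats `HodgeConjecture.HodgeConjecture`

noncomputable section

open scoped Matrix Kronecker
open NumberField IsDedekindDomain Matrix Topology
open Literature.NumberTheory.Automorphic Literature.NumberTheory.Automorphic.UnitaryGroup
open Literature.NumberTheory.GelbartRogawski1991 Literature.NumberTheory.GelbartRogawski1991.GRConstruction
open Literature.NumberTheory.GelbartRogawski1991.UnitaryDualPair
open Literature.NumberTheory.GelbartRogawski1991.UnitaryDualPair.LocalSplitting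
open Literature.NumberTheory.GelbartRogawski1991.AdaptedBlocks
open Literature.NumberTheory.K2Lit.SiegelDoubled
open Literature.RepresentationTheory.HeisenbergGroup
open Summit.HodgeConjecture.HodgeConjecture.Cruxes.HLiu418.K2LiuLocalSWSectionDefs
open Summit.HodgeConjecture.HodgeConjecture.Cruxes.HLiu418.K2LiuLocalSWTensorAdaptedBlocks
open Summit.HodgeConjecture.HodgeConjecture.Cruxes.HLiu418.K2LiuDoublingSchrodingerModelDefs
open Summit.HodgeConjecture.HodgeConjecture.Cruxes.HLiu418.K2LiuDoublingModelComparison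
open Summit.HodgeConjecture.HodgeConjecture.Cruxes.HLiu418.K2LiuKudlaRallisMapDeltaModel
open Summit.HodgeConjecture.HodgeConjecture.Cruxes.HLiu418.K2LiuDeltaSpTransportSiegelJunction
open Summit.HodgeConjecture.HodgeConjecture.Cruxes.HLiu418.K2LiuDeltaModelRealFrame
open Summit.HodgeConjecture.HodgeConjecture.Cruxes.HLiu418.K2LiuA7ValuePartnerBlocks
open Summit.HodgeConjecture.HodgeConjecture.Cruxes.HLiu418.K2LiuA7ValueInstanceDefs

namespace Summit.HodgeConjecture.HodgeConjecture.Cruxes.HLiu418.K2LiuA7ValueInstanceLeviLaw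

variable (L : Type) [Field L] [NumberField L] [IsCMField L]
variable {N M n : ℕ} (e : Fin N × Fin M ≃ Fin n)
  (dV : Fin N → L) (hdV : ∀ i, IsCMField.complexConj L (dV i) = dV i) (hdV0 : ∀ i, dV i ≠ 0)
  (dW : Fin M → L) (hdW : ∀ i, IsCMField.complexConj L (dW i) = dW i) (hdW0 : ∀ i, dW i ≠ 0)
variable {M₂ M' n' : ℕ} (eW : Fin M × Fin M₂ ≃ Fin M') (e' : Fin N × Fin M' ≃ Fin n')
  (dV' : Fin M₂ → L) (hdV' : ∀ k, IsCMField.complexConj L (dV' k) = dV' k) (hdV'0 : ∀ k, dV' k ≠ 0)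
variable (v : HeightOneSpectrum (𝓞 (Fp L)))
  -- the Δ-intertwiner of the BIG datum (★ β-3) and a CM-model splitting of the BIG doubled group lying over `ι`
  (Γ : SchwartzBruhat (Fin (n' + n') → v.adicCompletion (Fp L)) ≃ₗ[ℂ] SchwartzBruhat (Fin (n' + n') → v.adicCompletion (Fp L)))
  (hΓ : IsDeltaIntertwiner L e' dV hdV (tensorFrame L dW eW dV') (tensorFrame_real L dW hdW eW dV' hdV') v Γ)
  (s𝔻 : UnitaryGroup.localPi L (IsCMField.complexConj L) (n' + n') (hermD L e' dV hdV (tensorFrame L dW eW dV') (tensorFrame_real L dW hdW eW dV' hdV')) v →*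
    LocalMp (Fp L) (n' + n') (gramD L e' dV hdV (tensorFrame L dW eW dV') (tensorFrame_real L dW hdW eW dV' hdV')) v)
  (hsproj : ∀ g, MpPsi.proj _ (s𝔻 g) =
    iotaD (Fp L) L (IsCMField.complexConj L) (complexConj_imagUnit L) (imagUnit_ne_zero L) (imagUnit_mul_self L) v n'
      (gramR_isSymm L e' dV hdV (tensorFrame L dW eW dV') (tensorFrame_real L dW hdW eW dV' hdV'))
      (hermD_eq_map_gramD L e' dV hdV (tensorFrame L dW eW dV') (tensorFrame_real L dW hdW eW dV' hdV')) g)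

omit [IsCMField L] in
/-- `𝒮(L⁺_v^k) ≠ 0`: the indicator of the unit box (as in ★ `nontrivial_schwartzBruhat_pi`). [cite: MoeglinVignerasWaldspurger1987, Chap. 2 II.1 (B)] -/
theorem exists_schwartzBruhat_ne_zero (k : ℕ) : ∃ f₀ : SchwartzBruhat (Fin k → v.adicCompletion (Fp L)), f₀ ≠ 0 := by
  set f₀ : SchwartzBruhat (Fin k → v.adicCompletion (Fp L)) :=
    ⟨(piPrimePowBall (v.adicCompletion (Fp L)) (Fin k) 0).indicator fun _ => (1 : ℂ), indicator_piPrimePowBall_mem_schwartzBruhat 0 1⟩ with hf₀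
  refine ⟨f₀, fun h => ?_⟩
  have h0 := congrArg (fun f : SchwartzBruhat (Fin k → v.adicCompletion (Fp L)) => (f : (Fin k → v.adicCompletion (Fp L)) → ℂ) 0) h
  simp only [hf₀, Set.indicator_of_mem (zero_mem_piPrimePowBall (F := v.adicCompletion (Fp L)) (ι := Fin k) 0), ZeroMemClass.coe_zero,
    Pi.zero_apply, one_ne_zero] at h0

/-- each `aX m = leviRhoLoc v m` is continuous with continuous inverse (★ I-0 `continuous_leviAct(_symm)` read through ★ I-2 `leviRhoLoc_apply`). [folklore] -/
theorem continuous_leviRhoLoc (m : ↥(leviDeltaLoc L e dV hdV dW hdW v)) :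
    Continuous (leviRhoLoc L (complexConj_imagUnit L) (imagUnit_ne_zero L) e dV hdV dW hdW eW e' dV' hdV' v m) ∧
      Continuous (leviRhoLoc L (complexConj_imagUnit L) (imagUnit_ne_zero L) e dV hdV dW hdW eW e' dV' hdV' v m).symm := by
  rw [leviRhoLoc_apply]
  exact ⟨continuous_leviAct (Fp L) L (IsCMField.complexConj L) (complexConj_imagUnit L) (imagUnit_ne_zero L) v n' _,
    continuous_leviAct_symm (Fp L) L (IsCMField.complexConj L) (complexConj_imagUnit L) (imagUnit_ne_zero L) v n' _⟩

set_option maxHeartbeats 800000 in -- measured: matching the (A2d) and (β-1) currencies of the `ℓ_Δ`-pairing unfolds `deltaGramLoc ∕ gramRLoc`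
include hdV0 hdW0 hdV'0 hsproj in
/-- the symplectic part of `s^Δ_B m`, `m ∈ M_Δ`, is the Levi letter `leviSp (aX m) d` for some companion `d`: `proj (s^Δ_B m) = deltaCoords ∘ ι(m ⊗ 1) ∘ deltaCoords⁻¹`
(★ A2d junction `proj_transport_eq`) and `m ⊗ 1` is block-diagonal (★ I-1b), so the ★ I-0 bridge applies. [cite: Kudla1994, §3] [cite: MoeglinVignerasWaldspurger1987, Chap. 2 II.1 (B), II.6] -/
theorem exists_proj_transport_tensorEmbLoc_eq_leviSp (m : ↥(leviDeltaLoc L e dV hdV dW hdW v)) :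
    ∃ (d : (Fin (n' + n') → v.adicCompletion (Fp L)) ≃ₗ[v.adicCompletion (Fp L)] (Fin (n' + n') → v.adicCompletion (Fp L)))
      (had : ∀ x y : Fin (n' + n') → v.adicCompletion (Fp L),
        Matrix.toLinearMap₂' (v.adicCompletion (Fp L)) (deltaGramLoc L e' dV hdV (tensorFrame L dW eW dV') (tensorFrame_real L dW hdW eW dV' hdV') v)
            (leviRhoLoc L (complexConj_imagUnit L) (imagUnit_ne_zero L) e dV hdV dW hdW eW e' dV' hdV' v m x) (d y) =
          Matrix.toLinearMap₂' (v.adicCompletion (Fp L)) (deltaGramLoc L e' dV hdV (tensorFrame L dW eW dV') (tensorFrame_real L dW hdW eW dV' hdV') v) x y),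
      MpPsi.proj (localSchrodingerDelta L e' dV hdV (tensorFrame L dW eW dV') (tensorFrame_real L dW hdW eW dV' hdV') v)
          (mpTransportLoc L e' dV hdV (tensorFrame L dW eW dV') (tensorFrame_real L dW hdW eW dV' hdV') v Γ hΓ
            (s𝔻 (tensorEmbLoc L e dV hdV dW hdW eW e' dV' hdV' v (m : UnitaryGroup.localPi L (IsCMField.complexConj L) (n + n) (hermD L e dV hdV dW hdW) v)))) =
        leviSp _ (leviRhoLoc L (complexConj_imagUnit L) (imagUnit_ne_zero L) e dV hdV dW hdW eW e' dV' hdV' v m) d had := by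
  obtain ⟨d, had, heq⟩ := exists_deltaTransport_iotaD_eq_leviSp_leviAct (Fp L) L (IsCMField.complexConj L) (complexConj_imagUnit L) (imagUnit_ne_zero L) v n'
    (imagUnit_mul_self L) (gramR_isSymm L e' dV hdV (tensorFrame L dW eW dV') (tensorFrame_real L dW hdW eW dV' hdV'))
    (isUnit_det_gramR₀ L e' dV hdV hdV0 (tensorFrame L dW eW dV') (tensorFrame_real L dW hdW eW dV' hdV') (tensorFrame_ne_zero L dW eW dV' hdW0 hdV'0))
    (hermD_eq_map_gramD L e' dV hdV (tensorFrame L dW eW dV') (tensorFrame_real L dW hdW eW dV' hdV'))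
    (tensorEmbLoc L e dV hdV dW hdW eW e' dV' hdV' v (m : UnitaryGroup.localPi L (IsCMField.complexConj L) (n + n) (hermD L e dV hdV dW hdW) v))
    (blkB_matA_tensorEmbLoc_eq_zero L e dV hdV dW hdW eW e' dV' hdV' v m.2.1) (blkC_tensorEmbLoc_eq_zero_of_mem L e dV hdV dW hdW eW e' dV' hdV' v m)
    (leviBlkD L e dV hdV dW hdW eW e' dV' hdV' v m) (by unfold leviBlkD; rw [val_blkDGL])
  have key := proj_transport_eq L e' dV hdV (tensorFrame L dW eW dV') (tensorFrame_real L dW hdW eW dV' hdV') v Γ hΓ s𝔻 hsproj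
    (tensorEmbLoc L e dV hdV dW hdW eW e' dV' hdV' v (m : UnitaryGroup.localPi L (IsCMField.complexConj L) (n + n) (hermD L e dV hdV dW hdW) v))
  exact ⟨d, had, key.trans heq⟩

set_option maxHeartbeats 800000 in -- measured (~25 s): the composite splitting `mpTransportLoc Γ ∘ s_𝔻 ∘ tensorEmbLoc ∘ subtype` unfolds slowly
include hdV0 hdW0 hdV'0 hsproj in
/-- **THE LEVI LAW `hM` OF THE (A4″-KR) INSTANCE**: there is a character `χ_M : M_Δ →* ℂˣ` with `ω^Δ(s^Δ_B m) Φ = χ_M(m) • leviEquivSB (aX m) Φ` for every `m` in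
the Siegel Levi and every `Φ ∈ 𝒮(X_Δ)`, `s^Δ_B := mpTransportLoc Γ ∘ s_𝔻 ∘ tensorEmbLoc` (★ A2c through the ★ I-0 bridge and the ★ A2d junction).
[cite: Kudla1994, §3 Thm. 3.1] [cite: MoeglinVignerasWaldspurger1987, Chap. 2 II.1 (B), II.6] -/
theorem exists_character_toRep_levi :
    ∃ χM : ↥(leviDeltaLoc L e dV hdV dW hdW v) →* ℂˣ,
      ∀ (m : ↥(leviDeltaLoc L e dV hdV dW hdW v)) (Φ : SchwartzBruhat (Fin (n' + n') → v.adicCompletion (Fp L))),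
        MpPsi.toRep (localSchrodingerDelta L e' dV hdV (tensorFrame L dW eW dV') (tensorFrame_real L dW hdW eW dV' hdV') v)
            ((((mpTransportLoc L e' dV hdV (tensorFrame L dW eW dV') (tensorFrame_real L dW hdW eW dV' hdV') v Γ hΓ).toMonoidHom.comp
              (s𝔻.comp (tensorEmbLoc L e dV hdV dW hdW eW e' dV' hdV' v))).comp (leviDeltaLoc L e dV hdV dW hdW v).subtype) m) Φ =
          (χM m : ℂ) • leviEquivSB (leviRhoLoc L (complexConj_imagUnit L) (imagUnit_ne_zero L) e dV hdV dW hdW eW e' dV' hdV' v m)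
            (continuous_leviRhoLoc L e dV hdV dW hdW eW e' dV' hdV' v m).1 (continuous_leviRhoLoc L e dV hdV dW hdW eW e' dV' hdV' v m).2 Φ := by
  -- a non-zero Schwartz function: the indicator of the unit box (as in ★ `nontrivial_schwartzBruhat_pi`)
  obtain ⟨f₀, hf₀⟩ := exists_schwartzBruhat_ne_zero L v (n' + n')
  choose d had hp using exists_proj_transport_tensorEmbLoc_eq_leviSp L e dV hdV hdV0 dW hdW hdW0 eW e' dV' hdV' hdV'0 v Γ hΓ s𝔻 hsproj
  -- `hp` is literally the hypothesis of ★ A2c for the composite splitting (`MonoidHom.comp_apply` is `rfl`)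
  exact exists_character_toRep_eq_smul
    (Matrix.toLinearMap₂' (v.adicCompletion (Fp L)) (deltaGramLoc L e' dV hdV (tensorFrame L dW eW dV') (tensorFrame_real L dW hdW eW dV' hdV') v))
    (adeleAddCharAt (Fp L) v) (isLocallyConstant_of_isContinuousNontrivial (isContinuousNontrivial_adeleAddCharAt (Fp L) v))
    (K2LiuDoublingSchrodingerModelDefs.continuous_toLinearMap₂'_left L (deltaGramLoc L e' dV hdV (tensorFrame L dW eW dV') (tensorFrame_real L dW hdW eW dV' hdV') v))
    (K2LiuKudlaRallisMapDeltaModel.implementerUniqueUpToScalar_localSchrodingerDelta L e' dV hdV hdV0 (tensorFrame L dW eW dV')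
      (tensorFrame_real L dW hdW eW dV' hdV') (tensorFrame_ne_zero L dW eW dV' hdW0 hdV'0) v)
    _ _ d had _ _ (fun m => hp m) f₀ hf₀

end Summit.HodgeConjecture.HodgeConjecture.Cruxes.HLiu418.K2LiuA7ValueInstanceLeviLaw

end
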